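import Mathlib
import HarnessLib
import Summits.ValiantsHypothesis.ValiantsHypothesis.Theorems.LacunarySymmetroidMatrixDescartesProductPlusOneSharpKMonotone

/-!
# ValiantsHypothesis / LacunarySymmetroid — crux `MatrixDescartes` (stmt-ValiantsHypothesis-18050, V1),
# LINE (A) «product_plus_one»: the SHARP SECTOR for GENERAL `K` — part 3b, LOG-SCALE LAGUERRE FOR SHARP FEWNOMIALS

**`sharp_phi_strictAnti`**: if `f = Σ_{i ≤ K} c_i X^{d_i}` (`K ≥ 1`, `d` strictly increasing, all `c_i ≠ 0`) has `K` distinct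
positive zeros (Descartes-sharp), then `x f′(x)/f(x)` is STRICTLY DECREASING along every zero-free interval `[w₁, w₂] ⊂ (0, ∞)` —
for EVERY lacunary support.  (`K = 2`, three terms: ✓ `…SharpCalculus.logWronskian_neg` by an explicit certificate; dense supports:
Laguerre's inequality in logarithmic scale.)  From part 3a (`sharp_level_injective`) by choosing generic levels (finitely many
exceptions) and the intermediate value theorem, with the blow-up of `x f′/f` at the neighbouring zero (`exists_phi_gt_near_left_zero`
/ `exists_phi_lt_near_right_zero`) supplying the third point, and `θf − μf ≢ 0` excluding locally constant `x f′/f`.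

HONEST FRAMING: a per-factor theorem; NOT `stub_classRowK3`, not `stub_polyLaw`, not `ProductPlusOneMDR`, not `MatrixDescartes`, not
Conjecture B; `VP ≠ VNP` is NOT proved.  No definitions, no named facts; Mathlib + parts 1–3a.
-/

-- `Summit.ValiantsHypothesis.ValiantsHypothesis.…` is the tree's mandated single-conjunct layout (Sub = Summit).
set_option linter.dupNamespace false

namespace Summit.ValiantsHypothesis.ValiantsHypothesis.Theorems.LacunarySymmetroidMatrixDescartes

namespace ProductPlusOne

open Polynomial Finset
open scoped BigOperators

/-- A generic level exists in every nonempty open interval. [folklore] -/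
theorem exists_generic_level (K : ℕ) (d : ℕ → ℕ) {α β : ℝ} (hαβ : α < β) :
    ∃ μ ∈ Set.Ioo α β, ∀ i, i < K + 1 → (d i : ℝ) ≠ μ := by
  obtain ⟨μ, hμ, hnot⟩ := (Set.Ioo_infinite hαβ).exists_notMem_finset
    ((Finset.range (K + 1)).image (fun i => (d i : ℝ)))
  refine ⟨μ, hμ, fun i hi h => hnot ?_⟩
  rw [Finset.mem_image]
  exact ⟨i, Finset.mem_range.mpr hi, h⟩

/-- `x f′/f` is continuous on a zero-free interval. [folklore] -/
theorem phi_continuousOn (f : ℝ[X]) {a b : ℝ} (hfree : ∀ t ∈ Set.Icc a b, f.eval t ≠ 0) :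
    ContinuousOn (fun x : ℝ => x * (derivative f).eval x / f.eval x) (Set.Icc a b) :=
  (continuousOn_id.mul (derivative f).continuous.continuousOn).div f.continuous.continuousOn hfree

/-- A level of `x f′/f` at a non-zero of `f` is a zero of `X f′ − C μ f`. [folklore] -/
theorem euler_eval_eq_zero_of_phi (f : ℝ[X]) {t μ : ℝ} (hf : f.eval t ≠ 0)
    (h : t * (derivative f).eval t / f.eval t = μ) : (X * derivative f - C μ * f).eval t = 0 := by
  have : t * (derivative f).eval t = μ * f.eval t := by rw [← h, div_mul_cancel₀ _ hf]
  simp [this]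

/-- **LOG-SCALE LAGUERRE FOR DESCARTES-SHARP FEWNOMIALS**: `x f′/f` strictly decreases along every zero-free interval of a sharp
`(K+1)`-nomial, `K ≥ 1`, any support. [this file's theorem] -/
theorem sharp_phi_strictAnti (K : ℕ) (hK : 1 ≤ K) (d : ℕ → ℕ) (hd : StrictMono d) (c : ℕ → ℝ)
    (hc : ∀ i, i < K + 1 → c i ≠ 0)
    (hroots : K ≤ ((∑ i ∈ Finset.range (K + 1), C (c i) * X ^ (d i) : ℝ[X]).roots.toFinset.filter (fun t => 0 < t)).card)
    {w₁ w₂ : ℝ} (hw₁ : 0 < w₁) (hw : w₁ < w₂)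
    (hfree : ∀ t ∈ Set.Icc w₁ w₂, (∑ i ∈ Finset.range (K + 1), C (c i) * X ^ (d i) : ℝ[X]).eval t ≠ 0) :
    w₂ * (derivative (∑ i ∈ Finset.range (K + 1), C (c i) * X ^ (d i) : ℝ[X])).eval w₂
        / (∑ i ∈ Finset.range (K + 1), C (c i) * X ^ (d i) : ℝ[X]).eval w₂
      < w₁ * (derivative (∑ i ∈ Finset.range (K + 1), C (c i) * X ^ (d i) : ℝ[X])).eval w₁
        / (∑ i ∈ Finset.range (K + 1), C (c i) * X ^ (d i) : ℝ[X]).eval w₁ := by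
  classical
  set f : ℝ[X] := ∑ i ∈ Finset.range (K + 1), C (c i) * X ^ (d i) with hf
  set φ : ℝ → ℝ := fun x => x * (derivative f).eval x / f.eval x with hφ
  show φ w₂ < φ w₁
  have hf0 : f ≠ 0 := (sparse_leadingCoeff K d hd c (hc K (by omega))).2
  -- two points of one zero-free interval at a generic level are impossible
  have hinj : ∀ μ : ℝ, (∀ i, i < K + 1 → (d i : ℝ) ≠ μ) → ∀ t₁ t₂ : ℝ, 0 < t₁ → t₁ < t₂ →
      (∀ t ∈ Set.Icc t₁ t₂, f.eval t ≠ 0) → φ t₁ = μ → φ t₂ = μ → False := by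
    intro μ hgen t₁ t₂ ht₁ ht hfr h1 h2
    exact sharp_level_injective K hK d hd c hc hroots μ hgen ht₁ ht hfr
      (euler_eval_eq_zero_of_phi f (hfr t₁ ⟨le_rfl, ht.le⟩) h1)
      (euler_eval_eq_zero_of_phi f (hfr t₂ ⟨ht.le, le_rfl⟩) h2)
  -- IVT helpers on a zero-free [a, b]
  have hup : ∀ a b μ : ℝ, a < b → (∀ t ∈ Set.Icc a b, f.eval t ≠ 0) → φ a < μ → μ < φ b →
      ∃ t ∈ Set.Ioo a b, φ t = μ := by
    intro a b μ hab hfr h1 h2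
    obtain ⟨t, ht, e⟩ := intermediate_value_Ioo hab.le (phi_continuousOn f hfr) ⟨h1, h2⟩
    exact ⟨t, ht, e⟩
  have hdown : ∀ a b μ : ℝ, a < b → (∀ t ∈ Set.Icc a b, f.eval t ≠ 0) → φ b < μ → μ < φ a →
      ∃ t ∈ Set.Ioo a b, φ t = μ := by
    intro a b μ hab hfr h1 h2
    obtain ⟨t, ht, e⟩ := intermediate_value_Ioo' hab.le (phi_continuousOn f hfr) ⟨h1, h2⟩
    exact ⟨t, ht, e⟩
  -- zero set
  set Zf := f.roots.toFinset.filter (fun t => 0 < t) with hZf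
  have hZmem : ∀ t, t ∈ Zf ↔ 0 < t ∧ f.eval t = 0 := by
    intro t
    rw [hZf, mem_filter, Multiset.mem_toFinset, mem_roots hf0, IsRoot.def]
    tauto
  have hZne : Zf.Nonempty := Finset.card_pos.mp (by omega)
  have hzout : ∀ t ∈ Zf, t < w₁ ∨ w₂ < t := by
    intro t ht
    by_contra h
    push Not at h
    exact hfree t ⟨h.1, h.2⟩ ((hZmem t).mp ht).2
  by_contra hcon
  push Not at hcon
  rcases lt_or_eq_of_le hcon with hlt | heq
  · -- φ w₁ < φ w₂ : find a third point beyond one end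
    obtain ⟨μ, hμ, hgen⟩ := exists_generic_level K d hlt
    by_cases hL : (Zf.filter (fun t => t < w₁)).Nonempty
    · -- nearest zero on the left
      set zL := (Zf.filter (fun t => t < w₁)).max' hL with hzL
      have hzLmem : zL ∈ Zf.filter (fun t => t < w₁) := Finset.max'_mem _ hL
      rw [Finset.mem_filter] at hzLmem
      obtain ⟨hzLpos, hzLroot⟩ := (hZmem zL).mp hzLmem.1
      have hfreeL : ∀ t ∈ Set.Ioo zL w₂, f.eval t ≠ 0 := by
        intro t ht hft
        rcases lt_or_ge t w₁ with h | h
        · have htmem : t ∈ Zf.filter (fun s => s < w₁) := by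
            rw [Finset.mem_filter]; exact ⟨(hZmem t).mpr ⟨hzLpos.trans ht.1, hft⟩, h⟩
          have := Finset.le_max' _ t htmem
          rw [← hzL] at this
          linarith [ht.1]
        · exact hfree t ⟨h, ht.2.le⟩ hft
      have hdzL := derivative_ne_zero_of_sharp K d hd c hc hroots hzLpos hzLroot
      obtain ⟨w₀, hw₀, hφ₀⟩ := exists_phi_gt_near_left_zero f hzLpos hfreeL hzLroot hdzL ⟨hzLmem.2, hw⟩ (φ w₂)
      -- t₁ ∈ (w₀, w₁) and t₂ ∈ (w₁, w₂) at level μ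
      have hfr1 : ∀ t ∈ Set.Icc w₀ w₁, f.eval t ≠ 0 :=
        fun t ht => hfreeL t ⟨hw₀.1.trans_le ht.1, ht.2.trans_lt hw⟩
      obtain ⟨t₁, ht₁, e₁⟩ := hdown w₀ w₁ μ hw₀.2 hfr1 hμ.1 (hμ.2.trans hφ₀)
      obtain ⟨t₂, ht₂, e₂⟩ := hup w₁ w₂ μ hw hfree hμ.1 hμ.2
      exact hinj μ hgen t₁ t₂ ((hzLpos.trans hw₀.1).trans ht₁.1) (ht₁.2.trans ht₂.1)
        (fun t ht => hfreeL t ⟨hw₀.1.trans (ht₁.1.trans_le ht.1), ht.2.trans_lt ht₂.2⟩) e₁ e₂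
    · -- no zero on the left: nearest zero on the right
      set zR := Zf.min' hZne with hzR
      have hzRmem : zR ∈ Zf := Finset.min'_mem _ hZne
      obtain ⟨hzRpos, hzRroot⟩ := (hZmem zR).mp hzRmem
      have hzRgt : w₂ < zR := by
        rcases hzout zR hzRmem with h | h
        · exact absurd ⟨zR, by rw [Finset.mem_filter]; exact ⟨hzRmem, h⟩⟩ hL
        · exact h
      have hfreeR : ∀ t ∈ Set.Ioo 0 zR, f.eval t ≠ 0 := by
        intro t ht hft
        have := Finset.min'_le Zf t ((hZmem t).mpr ⟨ht.1, hft⟩)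
        rw [← hzR] at this
        linarith [ht.2]
      have hdzR := derivative_ne_zero_of_sharp K d hd c hc hroots hzRpos hzRroot
      obtain ⟨w₃, hw₃, hφ₃⟩ := exists_phi_lt_near_right_zero f le_rfl hfreeR hzRroot hdzR
        ⟨hw₁.trans hw, hzRgt⟩ (φ w₁)
      have hfr2 : ∀ t ∈ Set.Icc w₂ w₃, f.eval t ≠ 0 :=
        fun t ht => hfreeR t ⟨(hw₁.trans hw).trans_le ht.1, ht.2.trans_lt hw₃.2⟩
      obtain ⟨t₁, ht₁, e₁⟩ := hup w₁ w₂ μ hw hfree hμ.1 hμ.2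
      obtain ⟨t₂, ht₂, e₂⟩ := hdown w₂ w₃ μ hw₃.1 hfr2 (hφ₃.trans hμ.1) hμ.2
      exact hinj μ hgen t₁ t₂ (hw₁.trans ht₁.1) (ht₁.2.trans ht₂.1)
        (fun t ht => hfreeR t ⟨hw₁.trans (ht₁.1.trans_le ht.1), (ht.2.trans_lt ht₂.2).trans hw₃.2⟩) e₁ e₂
  · -- φ w₁ = φ w₂ =: v ; φ is not constant on (w₁, w₂)
    have hnc : ∃ t₀ ∈ Set.Ioo w₁ w₂, φ t₀ ≠ φ w₁ := by
      by_contra hall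
      push Not at hall
      have hg0 : (X * derivative f - C (φ w₁) * f) ≠ 0 := by
        rw [hf, euler_sparse (K + 1) d c (φ w₁)]
        exact euler_sparse_ne_zero K hK d hd c hc _
      apply hg0
      apply Polynomial.eq_zero_of_infinite_isRoot
      refine Set.Infinite.mono (fun t ht => ?_) (Set.Ioo_infinite hw)
      exact euler_eval_eq_zero_of_phi f (hfree t ⟨ht.1.le, ht.2.le⟩) (hall t ht)
    obtain ⟨t₀, ht₀, hne⟩ := hnc
    have hfrA : ∀ t ∈ Set.Icc w₁ t₀, f.eval t ≠ 0 := fun t ht => hfree t ⟨ht.1, ht.2.trans ht₀.2.le⟩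
    have hfrB : ∀ t ∈ Set.Icc t₀ w₂, f.eval t ≠ 0 := fun t ht => hfree t ⟨ht₀.1.le.trans ht.1, ht.2⟩
    rcases lt_or_gt_of_ne hne with hlt | hgt
    · -- φ t₀ < v
      obtain ⟨μ, hμ, hgen⟩ := exists_generic_level K d hlt
      obtain ⟨t₁, ht₁, e₁⟩ := hdown w₁ t₀ μ ht₀.1 hfrA hμ.1 hμ.2
      obtain ⟨t₂, ht₂, e₂⟩ := hup t₀ w₂ μ ht₀.2 hfrB hμ.1 (by rw [← heq]; exact hμ.2)
      exact hinj μ hgen t₁ t₂ (hw₁.trans ht₁.1) (ht₁.2.trans ht₂.1)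
        (fun t ht => hfree t ⟨ht₁.1.le.trans ht.1, ht.2.trans (ht₂.2.le)⟩) e₁ e₂
    · -- φ t₀ > v
      obtain ⟨μ, hμ, hgen⟩ := exists_generic_level K d hgt
      obtain ⟨t₁, ht₁, e₁⟩ := hup w₁ t₀ μ ht₀.1 hfrA hμ.1 hμ.2
      obtain ⟨t₂, ht₂, e₂⟩ := hdown t₀ w₂ μ ht₀.2 hfrB (by rw [← heq]; exact hμ.1) hμ.2
      exact hinj μ hgen t₁ t₂ (hw₁.trans ht₁.1) (ht₁.2.trans ht₂.1)
        (fun t ht => hfree t ⟨ht₁.1.le.trans ht.1, ht.2.trans (ht₂.2.le)⟩) e₁ e₂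

end ProductPlusOne

end Summit.ValiantsHypothesis.ValiantsHypothesis.Theorems.LacunarySymmetroidMatrixDescartes
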